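import Summits.ABC.ABC.Theses.RibetTakahashiSplit
import Literature.NumberTheory.EllipticCurves.SzpiroFreyProofs
import Literature.NumberTheory.EllipticCurves.DegreeConjectureAbc
import Literature.NumberTheory.DiophantineGeometry.MinimalDiscriminantNormProofs
import Summits.ABC.ABC.Theorems.RibetTakahashiSplitWeightedSzpiroBoundSlackTransfer
import Literature.NumberTheory.EllipticCurves.SzpiroBGEquivalenceProofs
import Literature.NumberTheory.DiophantineGeometry.ConductorRadicalProofs

/-!
# Route RibetTakahashiSplit — crux `WeightedSzpiroBound` (stmt-ABC-3272) is equivalent to `ABC`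

`WeightedSzpiroBound.abc_of : RibetTakahashiSplit.WeightedSzpiroBound → ABC`.  The Tamagawa-type weight
`T(E) = ∏_{p ∥ N} ord_p(Δ_min)` of the crux is absorbed by the slack: `∏_{p ∈ S} v_p(n) ≤ K_η n^η` for every `η > 0`
(`WeightedSzpiroBound.prod_factorization_le_rpow`), so on the global minimal Frey model `W₀` of an abc triple
(`exists_minimal_frey_model`: elliptic, minimal at every place, `N ∣ 2¹⁰ rad(abc)`, `c² ≤ 2|c₄(W₀)|`; semistable away
from `2` because `rad(abc)` is squarefree) the crux gives `H := max(|Δ(W₀)|, |c₄(W₀)|³) ≤ C (N·T)^{6+ε₁} ≤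
C K^{6+ε₁} N^{6+ε₁} H^{η(6+ε₁)}` (`T ≤ K |Δ(W₀)|^η ≤ K H^η`, `|Δ(W₀)| = |Δ_min|` by
`minimalDiscriminantNorm_eq_natAbs_holds`), whence `H^{1−θ} ≪ N^{6+ε₁}` (`θ = η(6+ε₁) < 1`,
`SlackTransfer.le_rpow_of_le_mul_rpow`), `c⁶ ≤ 8|c₄|³ ≤ 8H ≪ rad^{(6+ε₁)/(1−θ)} ≤ rad^{6(1+ε)}`.
Consequence recorded for the planner: `WeightedSzpiroBound.assembly_of_crux : RibetTakahashiSplit.Assembly` holds with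
the cruxes r2 (`ManyPrimeValuationProduct`) and r4 (`FewPrimeValuationProduct`) UNUSED — r3′ alone is ABC-equivalent
(with `WeightedSzpiroBound.of_generalizedSzpiroBG` and the tree's `abcLe_iff_generalizedSzpiroBG_holds`), as the
crux disprover and ideator 3 (`cruxImpliesABC`, evidence only) observed; this file makes it importable.
Conversely `WeightedSzpiroBound.of_generalizedSzpiroBG` (generalized Szpiro ⟹ crux, by `T(E) ≥ 1`:
`WeightedSzpiroBound.one_le_tamWeight`), so with the tree's `abcLe_iff_generalizedSzpiroBG_holds` (B–G 12.5.12):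
`WeightedSzpiroBound.iff_generalizedSzpiroBG` and `WeightedSzpiroBound.iff_abc : WeightedSzpiroBound ↔ ABC`.
-/

noncomputable section

-- `Summit.<Summit>.<Problem>` is the mandated summit-side namespace (CONVENTIONS §2); for the
-- single-conjunct summit `ABC` the two coincide, so the duplicate `ABC.ABC` is deliberate.
set_option linter.dupNamespace false

namespace Summit.ABC.ABC.Theorems

open Literature.NumberTheory
open Literature.NumberTheory.EllipticCurves
open Summit.ABC.ABC.Theses
open IsDedekindDomain

/-! ## Absorption of valuation products: `∏_{p ∈ S} v_p(n) ≤ K_η · n^η` -/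

/-- Termwise: for a prime `p` and `v : ℕ`, `v ≤ (η log 2)⁻¹ · p^{η v}` (`x ≤ eˣ` at `x = η v log p`,
and `log p ≥ log 2`). [folklore] -/
theorem WeightedSzpiroBound.cast_le_inv_mul_rpow {η : ℝ} (hη : 0 < η) {p : ℕ} (hp : p.Prime) (v : ℕ) :
    (v : ℝ) ≤ (η * Real.log 2)⁻¹ * (p : ℝ) ^ (η * v) := by
  have hp0 : (0 : ℝ) < p := by exact_mod_cast hp.pos
  have hlog2 : 0 < Real.log 2 := Real.log_pos (by norm_num)
  have hlogp : Real.log 2 ≤ Real.log p :=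
    Real.log_le_log (by norm_num) (by exact_mod_cast hp.two_le)
  have hc : 0 < η * Real.log 2 := mul_pos hη hlog2
  -- `η v log 2 ≤ η v log p ≤ exp (η v log p) = p ^ (η v)`
  have h1 : η * v * Real.log 2 ≤ Real.exp (η * v * Real.log p) :=
    calc η * v * Real.log 2 ≤ η * v * Real.log p :=
          mul_le_mul_of_nonneg_left hlogp (mul_nonneg hη.le (Nat.cast_nonneg v))
      _ ≤ η * v * Real.log p + 1 := by linarith
      _ ≤ Real.exp (η * v * Real.log p) := Real.add_one_le_exp _
  have h2 : Real.exp (η * v * Real.log p) = (p : ℝ) ^ (η * v) := by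
    rw [Real.rpow_def_of_pos hp0]; ring_nf
  rw [h2] at h1
  calc (v : ℝ) = (η * Real.log 2)⁻¹ * (η * v * Real.log 2) := by field_simp
    _ ≤ (η * Real.log 2)⁻¹ * (p : ℝ) ^ (η * v) :=
        mul_le_mul_of_nonneg_left h1 (inv_nonneg.mpr hc.le)

/-- Termwise, large primes: if `2 ≤ p^η` then `v ≤ p^{η v}` for every `v : ℕ` (`v ≤ 2^v ≤ (p^η)^v`). [folklore] -/
theorem WeightedSzpiroBound.cast_le_rpow_of_two_le {η : ℝ} {p : ℕ} (h2 : (2 : ℝ) ≤ (p : ℝ) ^ η)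
    (v : ℕ) : (v : ℝ) ≤ (p : ℝ) ^ (η * v) := by
  have hp0 : (0 : ℝ) ≤ p := Nat.cast_nonneg p
  have hv : (v : ℝ) ≤ (2 : ℝ) ^ (v : ℕ) := by exact_mod_cast Nat.lt_two_pow_self.le
  calc (v : ℝ) ≤ (2 : ℝ) ^ (v : ℕ) := hv
    _ ≤ ((p : ℝ) ^ η) ^ (v : ℕ) := pow_le_pow_left₀ (by norm_num) h2 v
    _ = (p : ℝ) ^ (η * v) := by rw [← Real.rpow_natCast, ← Real.rpow_mul hp0]

/-- **Absorption lemma.** For every `η > 0` there is `K > 0` such that for every `n ≥ 1` and every finite set `S`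
of primes, `∏_{p ∈ S} v_p(n) ≤ K · n^η` (`v_p(n) = n.factorization p`).  Proof: if some `p ∈ S` does not divide
`n` the product vanishes; otherwise it is at most `∏_{p ∣ n} v_p(n)`, and termwise `v_p ≤ c_p · p^{η v_p}` with
`c_p = 1` once `p^η ≥ 2` and `c_p = (η log 2)⁻¹` for the finitely many smaller primes, while
`∏_{p ∣ n} p^{η v_p} = n^η`. [folklore] -/
theorem WeightedSzpiroBound.prod_factorization_le_rpow {η : ℝ} (hη : 0 < η) :
    ∃ K : ℝ, 0 < K ∧ ∀ n : ℕ, 0 < n → ∀ S : Finset ℕ, (∀ p ∈ S, p.Prime) →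
      ((∏ p ∈ S, n.factorization p : ℕ) : ℝ) ≤ K * (n : ℝ) ^ η := by
  classical
  -- the threshold `P = ⌈2^{1/η}⌉₊` and the constant
  set c : ℝ := max 1 (η * Real.log 2)⁻¹ with hc
  set P : ℕ := ⌈(2 : ℝ) ^ (1 / η)⌉₊ with hP
  have hc1 : 1 ≤ c := le_max_left _ _
  have hc0 : 0 < c := one_pos.trans_le hc1
  refine ⟨c ^ P, pow_pos hc0 P, fun n hn S hS ↦ ?_⟩
  have hn0 : n ≠ 0 := hn.ne'
  have hnR : (0 : ℝ) < n := by exact_mod_cast hn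
  have hrhs0 : 0 ≤ c ^ P * (n : ℝ) ^ η := mul_nonneg (pow_nonneg hc0.le P) (Real.rpow_nonneg hnR.le η)
  by_cases hzero : ∃ p ∈ S, n.factorization p = 0
  · obtain ⟨p, hpS, hp0⟩ := hzero
    rw [Finset.prod_eq_zero hpS hp0, Nat.cast_zero]
    exact hrhs0
  push Not at hzero
  -- `S ⊆ n.primeFactors`, and the product over `S` is at most the product over all prime factors
  have hsub : S ⊆ n.primeFactors := fun p hp ↦
    Nat.support_factorization n ▸ Finsupp.mem_support_iff.mpr (hzero p hp)
  have hle1 : (∏ p ∈ S, n.factorization p) ≤ ∏ p ∈ n.primeFactors, n.factorization p :=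
    Finset.prod_le_prod_of_subset_of_one_le' hsub fun p hp _ ↦
      Nat.one_le_iff_ne_zero.mpr (Finsupp.mem_support_iff.mp (Nat.support_factorization n ▸ hp))
  -- termwise real bound with the constant `cp p = if p < P then c else 1`
  have hterm : ∀ p ∈ n.primeFactors, ((n.factorization p : ℕ) : ℝ) ≤
      (if p < P then c else 1) * (p : ℝ) ^ (η * (n.factorization p : ℕ)) := by
    intro p hp
    have hpp : p.Prime := Nat.prime_of_mem_primeFactors hp
    split_ifs with hlt
    · calc ((n.factorization p : ℕ) : ℝ) ≤ (η * Real.log 2)⁻¹ * (p : ℝ) ^ (η * (n.factorization p : ℕ)) :=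
            WeightedSzpiroBound.cast_le_inv_mul_rpow hη hpp _
        _ ≤ c * (p : ℝ) ^ (η * (n.factorization p : ℕ)) :=
            mul_le_mul_of_nonneg_right (le_max_right _ _) (Real.rpow_nonneg (Nat.cast_nonneg p) _)
    · have hPle : (P : ℝ) ≤ p := by exact_mod_cast not_lt.mp hlt
      have h2 : (2 : ℝ) ≤ (p : ℝ) ^ η := by
        have hceil : (2 : ℝ) ^ (1 / η) ≤ P := Nat.le_ceil _
        have hbase : (2 : ℝ) ^ (1 / η) ≤ p := hceil.trans hPle
        have := Real.rpow_le_rpow (by positivity) hbase hη.le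
        rwa [← Real.rpow_mul (by norm_num), one_div_mul_cancel hη.ne', Real.rpow_one] at this
      rw [one_mul]
      exact WeightedSzpiroBound.cast_le_rpow_of_two_le h2 _
  -- the product of the constants is at most `c ^ P`
  have hconst : (∏ p ∈ n.primeFactors, (if p < P then c else 1)) ≤ c ^ P := by
    rw [Finset.prod_ite, Finset.prod_const_one, mul_one, Finset.prod_const]
    have hcard : (n.primeFactors.filter (· < P)).card ≤ P :=
      calc (n.primeFactors.filter (· < P)).card ≤ (Finset.range P).card :=
            Finset.card_le_card fun p hp ↦ Finset.mem_range.mpr (Finset.mem_filter.mp hp).2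
        _ = P := Finset.card_range P
    exact pow_le_pow_right₀ hc1 hcard
  -- the product of the prime powers is `n ^ η`
  have hpow : (∏ p ∈ n.primeFactors, (p : ℝ) ^ (η * (n.factorization p : ℕ))) = (n : ℝ) ^ η := by
    have h1 : ∀ p ∈ n.primeFactors, (p : ℝ) ^ (η * (n.factorization p : ℕ)) =
        ((p : ℝ) ^ (n.factorization p : ℕ)) ^ η := fun p _ ↦ by
      rw [mul_comm, Real.rpow_mul (Nat.cast_nonneg p), Real.rpow_natCast]
    rw [Finset.prod_congr rfl h1, Real.finsetProd_rpow _ _ (fun p _ ↦ by positivity)]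
    congr 1
    have h2 : (∏ p ∈ n.primeFactors, (p : ℝ) ^ (n.factorization p : ℕ)) =
        ((∏ p ∈ n.primeFactors, p ^ n.factorization p : ℕ) : ℝ) := by push_cast; rfl
    rw [h2]
    congr 1
    conv_rhs => rw [← Nat.prod_factorization_pow_eq_self hn0]
    rw [Finsupp.prod, Nat.support_factorization]
  -- assemble
  calc ((∏ p ∈ S, n.factorization p : ℕ) : ℝ)
      ≤ ((∏ p ∈ n.primeFactors, n.factorization p : ℕ) : ℝ) := by exact_mod_cast hle1
    _ = ∏ p ∈ n.primeFactors, ((n.factorization p : ℕ) : ℝ) := by push_cast; rfl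
    _ ≤ ∏ p ∈ n.primeFactors, ((if p < P then c else 1) * (p : ℝ) ^ (η * (n.factorization p : ℕ))) :=
        Finset.prod_le_prod (fun _ _ ↦ Nat.cast_nonneg _) hterm
    _ = (∏ p ∈ n.primeFactors, (if p < P then c else 1)) *
          ∏ p ∈ n.primeFactors, (p : ℝ) ^ (η * (n.factorization p : ℕ)) := Finset.prod_mul_distrib
    _ ≤ c ^ P * (n : ℝ) ^ η := by
        rw [hpow]
        exact mul_le_mul_of_nonneg_right hconst (Real.rpow_nonneg hnR.le η)

/-! ## Generalized Szpiro implies the crux (`T(E) ≥ 1`) -/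

/-- `T(E) ≥ 1`: every prime of the conductor divides the minimal discriminant (same radical,
`radical_conductorNorm_eq_holds`, PROVED), so each factor `ord_p(Δ_min)` of the weight is `≥ 1`. [folklore] -/
theorem WeightedSzpiroBound.one_le_tamWeight (W : WeierstrassCurve ℚ) [W.IsElliptic] :
    1 ≤ ∏ p ∈ (W.conductorNorm ℤ).primeFactors with ¬ p ^ 2 ∣ W.conductorNorm ℤ,
      (W.minimalDiscriminantNorm ℤ).factorization p := by
  have hrad : UniqueFactorizationMonoid.radical (W.conductorNorm ℤ) =
      UniqueFactorizationMonoid.radical (W.minimalDiscriminantNorm ℤ) :=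
    W.radical_conductorNorm_eq_holds
  have hpf : (W.conductorNorm ℤ).primeFactors = (W.minimalDiscriminantNorm ℤ).primeFactors := by
    rw [← Nat.primeFactors_radical, hrad, Nat.primeFactors_radical]
  refine Nat.one_le_iff_ne_zero.mpr (Finset.prod_ne_zero_iff.mpr fun p hp ↦ ?_)
  rw [Finset.mem_filter] at hp
  have hp' : p ∈ (W.minimalDiscriminantNorm ℤ).primeFactors := hpf ▸ hp.1
  obtain ⟨hpp, hpd, hne⟩ := Nat.mem_primeFactors.mp hp'
  exact (hpp.factorization_pos_of_dvd hne hpd).ne'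

/-- **Generalized Szpiro ⟹ the weighted crux.**  `GeneralizedSzpiroConjectureBG` (Bombieri–Gubler Conj. 12.5.11:
`max(|Δ(W₀)|, |c₄(W₀)|³) ≤ C_ε N^{6+ε}` for global minimal models) implies `RibetTakahashiSplit.WeightedSzpiroBound`
(the same with `N` replaced by `N·T(E)`), since `T(E) ≥ 1` and `t ↦ t^{6+ε}` is monotone; the semistability
hypothesis of the crux is not used (the crux disprover's `crux ⟸ BG`, re-proved to be importable). [folklore] -/
theorem WeightedSzpiroBound.of_generalizedSzpiroBG (hBG : GeneralizedSzpiroConjectureBG) :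
    RibetTakahashiSplit.WeightedSzpiroBound := by
  intro ε hε
  obtain ⟨C, hC⟩ := hBG ε hε
  refine ⟨max C 0, fun W₀ hE hmin _hss ↦ ?_⟩
  haveI := hE
  have h1 := hC W₀ hE hmin
  set Nr : ℝ := (((W₀.baseChange ℚ).conductorNorm ℤ : ℕ) : ℝ) with hNr
  set Tr : ℝ := ((∏ p ∈ ((W₀.baseChange ℚ).conductorNorm ℤ).primeFactors with
      ¬ p ^ 2 ∣ (W₀.baseChange ℚ).conductorNorm ℤ,
        ((W₀.baseChange ℚ).minimalDiscriminantNorm ℤ).factorization p : ℕ) : ℝ) with hTr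
  have hN0 : (0 : ℝ) ≤ Nr := Nat.cast_nonneg _
  have hT1 : (1 : ℝ) ≤ Tr := by
    rw [hTr]; exact_mod_cast WeightedSzpiroBound.one_le_tamWeight (W₀.baseChange ℚ)
  have hle : Nr ≤ Nr * Tr := le_mul_of_one_le_right hN0 hT1
  have hexp : (0 : ℝ) ≤ 6 + ε := by linarith
  have hpow : Nr ^ (6 + ε) ≤ (Nr * Tr) ^ (6 + ε) := Real.rpow_le_rpow hN0 hle hexp
  have hpow0 : (0 : ℝ) ≤ Nr ^ (6 + ε) := Real.rpow_nonneg hN0 _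
  calc ((max |W₀.Δ| (|W₀.c₄| ^ 3) : ℤ) : ℝ) ≤ C * Nr ^ (6 + ε) := h1
    _ ≤ max C 0 * Nr ^ (6 + ε) := mul_le_mul_of_nonneg_right (le_max_left _ _) hpow0
    _ ≤ max C 0 * (Nr * Tr) ^ (6 + ε) := mul_le_mul_of_nonneg_left hpow (le_max_right _ _)

/-! ## The crux implies `abc` -/

/-- Exponent bookkeeping: for `0 < x ≤ 1` and `θ = x(6+x)/20`, `(6 + x)/(1 − θ) ≤ 6(1 + x)`. [folklore] -/
theorem WeightedSzpiroBound.exponent_le {x : ℝ} (hx : 0 < x) (hx1 : x ≤ 1) :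
    (6 + x) / (1 - x / 20 * (6 + x)) ≤ 6 * (1 + x) := by
  have hθ : 0 < 1 - x / 20 * (6 + x) := by nlinarith
  rw [div_le_iff₀ hθ]
  nlinarith [mul_pos hx hx, mul_nonneg hx.le (mul_nonneg hx.le hx.le)]

/-- **The weighted crux implies the strong abc-conjecture in the `≤`-form** (Bombieri–Gubler 12.2.2).  For an abc
triple take the global minimal Frey model `W₀` (`exists_minimal_frey_model`): it is semistable away from `2`
(`N ∣ 2¹⁰ rad(abc)` and `rad` is squarefree), so the crux applies: `H := max(|Δ(W₀)|, |c₄(W₀)|³) ≤ C (N·T)^{6+x}`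
with `T = ∏_{p ∥ N} v_p(|Δ_min|) ≤ K |Δ_min|^{x/20} ≤ K H^{x/20}` (`prod_factorization_le_rpow`;
`|Δ_min| = |Δ(W₀)|` for the minimal model, `minimalDiscriminantNorm_eq_natAbs_holds`); the self-improving
inequality `H ≤ K′ N^{6+x} H^{θ}`, `θ = (x/20)(6+x) < 1`, gives `H ≤ K′^{1/(1−θ)} N^{(6+x)/(1−θ)}`
(`SlackTransfer.le_rpow_of_le_mul_rpow`), and `c⁶ ≤ 8|c₄|³ ≤ 8H`, `N ≤ 2¹⁰ rad`, `(6+x)/(1−θ) ≤ 6(1+x)`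
(`x = min ε 1`) finish by sixth roots (`le_of_pow_six_le`). [folklore] -/
theorem WeightedSzpiroBound.abcLe_of (hW : RibetTakahashiSplit.WeightedSzpiroBound) :
    ∀ ε : ℝ, 0 < ε → ∃ C : ℝ, ∀ a b c : ℕ, DiophantineGeometry.IsABCTriple a b c →
      (c : ℝ) ≤ C * ((DiophantineGeometry.rad a b c : ℕ) : ℝ) ^ (1 + ε) := by
  intro ε hε
  -- parameters depending on `ε` only
  set x : ℝ := min ε 1 with hxdef
  have hx : 0 < x := lt_min hε one_pos
  have hx1 : x ≤ 1 := min_le_right _ _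
  have hxε : x ≤ ε := min_le_left _ _
  set η : ℝ := x / 20 with hηdef
  have hη : 0 < η := by positivity
  set θ : ℝ := η * (6 + x) with hθdef
  have hθ1 : θ < 1 := by rw [hθdef, hηdef]; nlinarith
  have h1θ : 0 < 1 - θ := sub_pos.mpr hθ1
  obtain ⟨C₁, hC₁⟩ := hW x hx
  obtain ⟨K, hK, hKabs⟩ := WeightedSzpiroBound.prod_factorization_le_rpow hη
  set C : ℝ := max C₁ 1 with hCdef
  have hC0 : 0 < C := one_pos.trans_le (le_max_right _ _)
  set K₁ : ℝ := (C * K ^ (6 + x)) ^ (1 / (1 - θ)) with hK₁def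
  have hK₁ : 0 ≤ K₁ := by positivity
  set e : ℝ := (6 + x) / (1 - θ) with hedef
  have he0 : 0 ≤ e := by positivity
  have he6 : e ≤ 6 * (1 + ε) := by
    have h := WeightedSzpiroBound.exponent_le hx hx1
    have h' : e ≤ 6 * (1 + x) := by rw [hedef, hθdef, hηdef]; simpa [mul_comm] using h
    nlinarith
  set M : ℝ := 8 * K₁ * ((2 : ℝ) ^ 10) ^ e with hMdef
  have hM : 0 ≤ M := by positivity
  refine ⟨M ^ (1 / 6 : ℝ), fun a b c h ↦ ?_⟩
  obtain ⟨W₀, hE, hmin, hNdvd, hc₄⟩ := exists_minimal_frey_model h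
  haveI := hE
  set R : ℝ := ((DiophantineGeometry.rad a b c : ℕ) : ℝ) with hRdef
  have hRpos : 0 < DiophantineGeometry.rad a b c := by
    rw [DiophantineGeometry.rad_def]; exact Nat.radical_pos _
  have hR : (1 : ℝ) ≤ R := by rw [hRdef]; exact_mod_cast hRpos
  -- semistability away from 2: `p` odd, `p² ∣ N ∣ 2¹⁰ rad` would force `p² ∣ rad`, but `rad` is squarefree
  have hss : ∀ p : ℕ, p.Prime → p ≠ 2 → ¬ p ^ 2 ∣ (W₀.baseChange ℚ).conductorNorm ℤ := by
    intro p hp hp2 hdvd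
    have h1 : p ^ 2 ∣ 2 ^ 10 * DiophantineGeometry.rad a b c := hdvd.trans hNdvd
    have hcop : Nat.Coprime (p ^ 2) (2 ^ 10) :=
      Nat.Coprime.pow _ _ ((Nat.coprime_primes hp Nat.prime_two).mpr hp2)
    have h2 : p ^ 2 ∣ DiophantineGeometry.rad a b c := hcop.dvd_of_dvd_mul_left h1
    have hsq : Squarefree (DiophantineGeometry.rad a b c) := by
      rw [DiophantineGeometry.rad_def]; exact UniqueFactorizationMonoid.squarefree_radical
    have := hsq p (by simpa [sq] using h2)
    exact hp.not_isUnit (by simpa using this)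
  -- the crux on `W₀`
  have key := hC₁ W₀ hE hmin hss
  set N : ℝ := (((W₀.baseChange ℚ).conductorNorm ℤ : ℕ) : ℝ) with hNdef
  set T : ℕ := ∏ p ∈ ((W₀.baseChange ℚ).conductorNorm ℤ).primeFactors with
      ¬ p ^ 2 ∣ (W₀.baseChange ℚ).conductorNorm ℤ,
        ((W₀.baseChange ℚ).minimalDiscriminantNorm ℤ).factorization p with hTdef
  set H : ℝ := ((max |W₀.Δ| (|W₀.c₄| ^ 3) : ℤ) : ℝ) with hHdef
  have hNpos : 0 < N := by
    rw [hNdef]; exact_mod_cast WeierstrassCurve.conductorNorm_pos_holds (W₀.baseChange ℚ)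
  have hNR : N ≤ 2 ^ 10 * R := by
    have := Nat.le_of_dvd (mul_pos (by positivity) hRpos) hNdvd
    rw [hNdef, hRdef]; exact_mod_cast this
  -- `|Δ_min| = |Δ(W₀)| ≤ H`, `H ≥ 1`
  have hΔ0 : W₀.Δ ≠ 0 := by
    intro h0
    apply hE.isUnit.ne_zero
    simp [WeierstrassCurve.baseChange, WeierstrassCurve.map_Δ, h0]
  have hΔmin : (W₀.baseChange ℚ).minimalDiscriminantNorm ℤ = W₀.Δ.natAbs :=
    WeierstrassCurve.minimalDiscriminantNorm_eq_natAbs_holds W₀ hΔ0 hmin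
  have hΔpos : 0 < (W₀.baseChange ℚ).minimalDiscriminantNorm ℤ :=
    WeierstrassCurve.minimalDiscriminantNorm_pos_holds _
  have hΔH : (((W₀.baseChange ℚ).minimalDiscriminantNorm ℤ : ℕ) : ℝ) ≤ H := by
    rw [hΔmin, hHdef, Nat.cast_natAbs]
    exact Int.cast_le.mpr (le_max_left _ _)
  have hΔ1 : (1 : ℝ) ≤ (((W₀.baseChange ℚ).minimalDiscriminantNorm ℤ : ℕ) : ℝ) := by exact_mod_cast hΔpos
  have hH1 : 1 ≤ H := hΔ1.trans hΔH
  have hH0 : 0 < H := one_pos.trans_le hH1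
  -- `T ≤ K |Δ_min|^η ≤ K H^η`
  have hT : (T : ℝ) ≤ K * H ^ η := by
    have h1 := hKabs _ hΔpos (((W₀.baseChange ℚ).conductorNorm ℤ).primeFactors.filter
      (fun p ↦ ¬ p ^ 2 ∣ (W₀.baseChange ℚ).conductorNorm ℤ))
      (fun p hp ↦ Nat.prime_of_mem_primeFactors (Finset.mem_filter.mp hp).1)
    rw [hTdef]
    exact h1.trans (mul_le_mul_of_nonneg_left (Real.rpow_le_rpow (by positivity) hΔH hη.le) hK.le)
  have hT0 : (0 : ℝ) ≤ T := Nat.cast_nonneg T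
  -- `H ≤ C (N T)^{6+x} ≤ (C K^{6+x} N^{6+x}) · H^θ`
  have h6x : (0 : ℝ) ≤ 6 + x := by linarith
  have hH : H ≤ (C * K ^ (6 + x) * N ^ (6 + x)) * H ^ θ := by
    have k1 : H ≤ C₁ * (N * T) ^ (6 + x) := key
    have hNT0 : 0 ≤ (N * T) ^ (6 + x) := Real.rpow_nonneg (mul_nonneg hNpos.le hT0) _
    calc H ≤ C₁ * (N * T) ^ (6 + x) := k1
      _ ≤ C * (N * T) ^ (6 + x) := mul_le_mul_of_nonneg_right (le_max_left _ _) hNT0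
      _ ≤ C * (N * (K * H ^ η)) ^ (6 + x) :=
          mul_le_mul_of_nonneg_left (Real.rpow_le_rpow (mul_nonneg hNpos.le hT0)
            (mul_le_mul_of_nonneg_left hT hNpos.le) h6x) hC0.le
      _ = (C * K ^ (6 + x) * N ^ (6 + x)) * H ^ θ := by
          rw [Real.mul_rpow hNpos.le (by positivity), Real.mul_rpow hK.le (by positivity),
            ← Real.rpow_mul hH0.le, hθdef]
          ring
  -- self-improvement
  have hH' : H ≤ K₁ * N ^ e := by
    have h := TwoAdicEisensteinAnchor.SlackTransfer.le_rpow_of_le_mul_rpow hH0 hθ1 hH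
    rw [Real.mul_rpow (by positivity) (Real.rpow_nonneg hNpos.le _), ← Real.rpow_mul hNpos.le] at h
    rw [hK₁def, hedef, div_eq_mul_one_div (6 + x) (1 - θ)]
    exact h
  -- `c⁶ ≤ 8 |c₄|³ ≤ 8 H ≤ 8 K₁ (2¹⁰ R)^e = M R^e`
  have hc2 : (c : ℝ) ^ 2 ≤ 2 * |(W₀.c₄ : ℝ)| := by exact_mod_cast hc₄
  have hc₄H : |(W₀.c₄ : ℝ)| ^ 3 ≤ H := by
    have hz : |W₀.c₄| ^ 3 ≤ max |W₀.Δ| (|W₀.c₄| ^ 3) := le_max_right _ _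
    have hr : ((|W₀.c₄| ^ 3 : ℤ) : ℝ) ≤ H := by rw [hHdef]; exact_mod_cast hz
    simpa [Int.cast_pow, Int.cast_abs] using hr
  have h6 : (c : ℝ) ^ 6 ≤ M * R ^ e := by
    have h := TwoAdicEisensteinAnchor.SlackTransfer.pow_six_le hK₁ hNpos he0 hc2 hc₄H hH' hNR
    calc (c : ℝ) ^ 6 ≤ 8 * K₁ * (2 ^ 10 * R) ^ e := h
      _ = M * R ^ e := by rw [hMdef, Real.mul_rpow (by positivity) (by positivity)]; ring
  exact le_of_pow_six_le (Nat.cast_nonneg c) hM hR he6 h6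

/-- **The crux alone implies the summit statement**: `RibetTakahashiSplit.WeightedSzpiroBound → ABC`
(`≤`-form ⟹ strict form with positive constant, `abcLt_of_abcLe`; `ABC` unfolds to it, `ABC_iff`). [folklore] -/
theorem WeightedSzpiroBound.abc_of (hW : RibetTakahashiSplit.WeightedSzpiroBound) : _root_.ABC :=
  _root_.ABC_iff.mpr (abcLt_of_abcLe (WeightedSzpiroBound.abcLe_of hW))

/-- **The crux is equivalent to generalized Szpiro** (Bombieri–Gubler 12.5.11): `⟹` via `abcLe_of` and the tree's
`abcLe_iff_generalizedSzpiroBG_holds` (B–G 12.5.12 (a) ⟹ (c)); `⟸` is `of_generalizedSzpiroBG`. [folklore] -/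
theorem WeightedSzpiroBound.iff_generalizedSzpiroBG :
    RibetTakahashiSplit.WeightedSzpiroBound ↔ GeneralizedSzpiroConjectureBG :=
  ⟨fun hW ↦ abcLe_iff_generalizedSzpiroBG_holds.mp (WeightedSzpiroBound.abcLe_of hW),
    WeightedSzpiroBound.of_generalizedSzpiroBG⟩

/-- **The crux is equivalent to the summit statement `ABC`** (strict form ⟹ `≤`-form trivially; `≤`-form ⟹
generalized Szpiro ⟹ crux). [folklore] -/
theorem WeightedSzpiroBound.iff_abc : RibetTakahashiSplit.WeightedSzpiroBound ↔ _root_.ABC := by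
  refine ⟨WeightedSzpiroBound.abc_of, fun hABC ↦ WeightedSzpiroBound.of_generalizedSzpiroBG
    (abcLe_iff_generalizedSzpiroBG_holds.mp fun ε hε ↦ ?_)⟩
  obtain ⟨C, _, hC⟩ := _root_.ABC_iff.mp hABC ε hε
  exact ⟨C, fun a b c h ↦ (hC a b c h).le⟩

/-- **Route consequence**: the route's `Assembly` (`ManyPrimeValuationProduct → FewPrimeValuationProduct →
WeightedSzpiroBound → ABC`, item stmt-ABC-11012) holds with the first two cruxes UNUSED — r3′ is ABC-equivalent by
itself. [folklore] -/
theorem WeightedSzpiroBound.assembly_of_crux : RibetTakahashiSplit.Assembly :=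
  fun _ _ hW ↦ WeightedSzpiroBound.abc_of hW

end Summit.ABC.ABC.Theorems

end
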